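import Summits.CriticalPhenomena.PercolationContinuityZ3.Theorems.PercNearOneGluingNoHeavyLowerTailUniformCertLeFive
import Summits.CriticalPhenomena.PercolationContinuityZ3.Theorems.AdditiveGluing.Negative.CertIsoSix

/-!
# `NoHeavyLowerTail` (crux stmt-CriticalPhenomena-4575 ≡ KN Conjecture 3), certificate programme:
# additive gluing at EVERY uniform density on all simple graphs with at most SIX vertices
# (the level-count certificate, one graph per isomorphism class)

The level-count checker `lvGraph` of `…UniformCertLeFiveChecker.lean` tests, for ONE edge list, the
level-wise form of additive gluing (AG) AND the convolution form of Kozma–Nitzan's Conjecture 1 (KN);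
its data are certified there (`lvSum_spec`, `lvCnt_eq_card`) and the bridge
`…UniformLevelCounting.lean` (`P_p(D) = Σ_k #_k(D) p^k (1 − p)^{m−k}`) turns level-wise count
dominance into inequalities valid for every `p ∈ [0, 1]` at once.  On six vertices the convolution
(KN) test is no longer passed by every instance, but the level-wise AG test is (the lead checked this
off-tree by exact enumeration: `0` failures on the `156` isomorphism classes).  This file makes the AG
half kernel-checked on `Fin 6`:

* `lvGraphAG n es` — the AG half of `lvGraph` (same histograms, same level vectors): for all `o ≠ b`,
  `A ∌ o`, `A ≠ ∅`: `∃ a ∈ A, ∀ k ≤ m, #_k{o ↔ A, o ↮ b} + #_k{a ↔ b} ≤ C(m, k)`;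
* `goIsoL`, `agIsoL n` — the search over all sub-lists of `allPairs n` carrying the code of the prefix,
  every leaf being either skipped as NON-MINIMAL in its orbit under the symmetric group (`nonMinimal`,
  `permTabs` of `CertIsoSix.lean`) or checked by `lvGraphAG`;
* soundness: `lvGraphAG_spec`, `real_diff_le_of_lvGraphAG` (the relay bound
  `P_p({o ↔ A} ∖ {o ↔ b}) ≤ 1 − P_p(a ↔ b)` for every `p`), `additiveGluing_uniform_of_lvGraphAG`,
  `reachDiff_uniform_of_lvGraphAG`; `goIsoL_imp`, `exists_lvGraphAG_of_agIsoL` (for `G` take `σ`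
  minimising `codeG (G.map σ)`: that leaf is never skipped), the relabelling invariance of the
  probabilities at every `p` (`real_openConn_map_perm`, `real_iUnion_openConn_map_perm`,
  `real_diff_map_perm`), `additiveGluing_uniform_of_agIsoL`, `reachDiff_uniform_of_agIsoL`;
* THE CERTIFICATE `agIsoL_six : agIsoL 6 = true` (`native_decide`, ≈ 65 s compiled: `2^15` leaves,
  `156` of them checked, `141 795` sub-configurations) and the smaller `n`, hence the registered stubs
  `additiveGluing_uniform_le_six` and `additiveGluing_uniform_completeSix`, and `reachDiff_uniform_le_six`:
  for every `n ≤ 6`, every `G : SimpleGraph (Fin n)`, EVERY `p ∈ [0, 1]` and all `A o b`,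
  `P_p(o ↔ A) − t ≤ P_p(o ↔ b)` whenever `t ≥ 0` and `P_p(a ↔ b) ≥ 1 − t` on `A`.

Sorry-free with the standard axioms plus `Lean.ofReduceBool` confined to the seven evaluations
`agIsoL_zero … agIsoL_six`.  Nothing here asserts or refutes the crux; no proposition is defined
(only computable Boolean functions).
-/

namespace Summit.CriticalPhenomena.PercolationContinuityZ3.Theorems

open MeasureTheory
open Literature.Probability.LatticeModels Literature.Probability.Percolation
open Summit.CriticalPhenomena.PercolationContinuityZ3.Theorems.AdditiveGluing.Negative.Cert

/-! ## Part 1. The checker and the pruned search (computable; evaluated by `native_decide`) -/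

section Checker

/-- THE PER-GRAPH CHECK, additive-gluing half of `lvGraph` (edge list `es` on `Fin n`, `m = |es|`):
for every source `o`, every vertex set `A` (mask `Am`) with `A ≠ ∅`, `o ∉ A`, and every `b ≠ o`,
`∃ a ∈ A, ∀ k ≤ m, #_k{o ↔ A, o ↮ b} + #_k{a ↔ b} ≤ C(m, k)` (level vectors read off the level
histograms `lvHist` by `lvSum`; `cl[a][b]` = level vector of `{a ↔ b}`). -/
def lvGraphAG (n : ℕ) (es : List (Fin n × Fin n)) : Bool :=
  let m := es.length
  let d := lvTabs n es
  let hs := (List.range n).map fun o => lvHist n m d o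
  let os := hs.map fun h => occL n m h
  let cl := (List.range n).map fun a => (List.range n).map fun b =>
    lvSum m (hs.getD a #[]) (os.getD a []) fun T => T.testBit b
  (List.range n).all fun o =>
    (List.range (2 ^ n)).all fun Am => Am == 0 || Am.testBit o ||
      (List.range n).all fun b => o == b ||
        (let u := lvSum m (hs.getD o #[]) (os.getD o []) fun T => T &&& Am != 0 && !T.testBit b
        (List.range n).any fun a => Am.testBit a &&
          (List.range (m + 1)).all fun k =>
            decide ((u[k]?).getD 0 + (((cl.getD a []).getD b #[])[k]?).getD 0 ≤ m.choose k))

/-- The search over all sub-lists of the pair list, carrying the chosen prefix `es` and its code `c`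
(bit `slot n i j` for the pair `(i, j)`): a leaf is skipped if some tabulated permutation lowers its
code (`nonMinimal`), otherwise it must pass `lvGraphAG`. -/
def goIsoL (n : ℕ) (pt : List (List (Fin n))) :
    List (Fin n × Fin n) → List (Fin n × Fin n) → ℕ → Bool
  | [], es, c => nonMinimal n pt c || lvGraphAG n es
  | p :: ps, es, c => goIsoL n pt ps es c && goIsoL n pt ps (es ++ [p]) (c ||| 2 ^ slot n p.1 p.2)

/-- THE PRUNED CHECK: `lvGraphAG` on every simple graph on `Fin n` up to isomorphism. -/
def agIsoL (n : ℕ) : Bool := goIsoL n (permTabs n) (allPairs n) [] 0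

end Checker

/-! ## Part 2. What `lvGraphAG n (edgeList G) = true` gives, at every density -/

/-- What `lvGraphAG n es = true` says: for `o ≠ b`, `A ≠ ∅` (mask `Am < 2^n`), `o ∉ A`, some relay
`a ∈ A` has `#_k{o ↔ A, o ↮ b} + #_k{a ↔ b} ≤ C(m, k)` for every level `k ≤ m`. -/
theorem lvGraphAG_spec {n : ℕ} {es : List (Fin n × Fin n)} (h : lvGraphAG n es = true) (o b : Fin n)
    (hob : o ≠ b) {Am : ℕ} (hAm : Am < 2 ^ n) (hAm0 : Am ≠ 0) (hAo : Am.testBit o = false) :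
    ∃ a : Fin n, Am.testBit a = true ∧ ∀ k, k ≤ es.length →
      lvCnt n es o (fun T => T &&& Am != 0 && !T.testBit b) k + lvCnt n es a (fun T => T.testBit b) k ≤
        es.length.choose k := by
  simp only [lvGraphAG, List.all_eq_true, List.mem_range, Bool.or_eq_true, beq_iff_eq] at h
  have h1 := ((h o o.2 Am hAm).resolve_left (not_or.2 ⟨hAm0, by rw [hAo]; exact Bool.false_ne_true⟩))
    b b.2
  have h2 := h1.resolve_left (fun e => hob (Fin.ext e))
  obtain ⟨a, ha, hh⟩ := List.any_eq_true.1 h2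
  rw [List.mem_range] at ha
  rw [Bool.and_eq_true, List.all_eq_true] at hh
  refine ⟨⟨a, ha⟩, hh.1, fun k hk => ?_⟩
  have hk' := hh.2 k (List.mem_range.2 (Nat.lt_succ_of_le hk))
  simp only [List.map_map, Function.comp_def, getD_map_range _ _ o.2, getD_map_range _ _ ha,
    getD_map_range _ _ b.2, decide_eq_true_eq] at hk'
  rwa [lvSum_spec es o _ hk, lvSum_spec es ⟨a, ha⟩ _ hk] at hk'

open Classical in
/-- The relay at the measure level: if `lvGraphAG n (edgeList G)` holds then for `o ∉ A`, `o ≠ b`,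
`A ≠ ∅` some `a ∈ A` has `P_p({o ↔ A} ∖ {o ↔ b}) ≤ 1 − P_p(a ↔ b)` for EVERY `p` (level-wise
dominance `#_k{o ↔ A, o ↮ b} ≤ #_k{a ↮ b}` and `uniformOn_real_mono_of_levelCount_le`). -/
theorem real_diff_le_of_lvGraphAG {n : ℕ} (G : SimpleGraph (Fin n)) (hg : lvGraphAG n (edgeList G) = true)
    (p : unitInterval) (A : Finset (Fin n)) (o b : Fin n) (hoA : o ∉ A) (hob : o ≠ b) {a₀ : Fin n}
    (ha₀ : a₀ ∈ A) :
    ∃ a ∈ A, (bondPercolation G p).real ((⋃ a ∈ A, openConn o a) \ openConn o b) ≤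
      1 - (bondPercolation G p).real (openConn a b) := by
  set es := edgeList G with hes
  have hnd : (es.map mkE).Nodup := nodup_map_mk_of_sublist (edgeList_sublist G)
  obtain ⟨a, hta, hle⟩ := lvGraphAG_spec hg o b hob (maskL_lt A.toList) (maskL_ne_zero ha₀)
    (testBit_maskL_eq_false hoA)
  refine ⟨a, mem_of_testBit_maskL hta, ?_⟩
  rw [← probReal_compl_eq_one_sub (measurableSet_openConn_holds a b),
    bondPercolation_eq_prodBernoulli_uniformOn G p, ← hes]
  set D₁ : Set (Set (Sym2 (Fin n))) := (⋃ a ∈ A, openConn o a) \ openConn o b with hD₁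
  have hQ₁ : ∀ ω : List (Fin n × Fin n),
      (fun T => T &&& maskL A.toList != 0 && !T.testBit b) ((reachTable n ω).getD o 0) = true ↔
        (↑(Eset ω) : Set (Sym2 (Fin n))) ∈ D₁ := fun ω => by
    rw [Bool.and_eq_true, and_maskL_iff_mem_iUnion, Bool.not_eq_true', Bool.eq_false_iff, ne_eq,
      testBit_reachTable_iff_mem_openConn, hD₁, Set.mem_sdiff]
  have hQ₂ : ∀ ω : List (Fin n × Fin n), (fun T => T.testBit b) ((reachTable n ω).getD a 0) = true ↔
      (↑(Eset ω) : Set (Sym2 (Fin n))) ∈ openConn a b :=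
    fun ω => testBit_reachTable_iff_mem_openConn ω a b
  refine uniformOn_real_mono_of_levelCount_le (Eset es) p D₁ (openConn a b)ᶜ fun k => ?_
  by_cases hk : k ≤ es.length
  · have h1 := hle k hk
    rw [lvCnt_eq_card hnd o _ D₁ hQ₁, lvCnt_eq_card hnd a _ (openConn a b) hQ₂,
      ← length_eq_card_Eset hnd] at h1
    have h2 := levelCount_add_compl (Eset es) (openConn a b) (openConn a b)ᶜ
      (fun S => Set.mem_compl_iff _ _) k
    omega
  · have h0 := levelCount_eq_zero (Eset es) D₁ (k := k) (by rw [length_eq_card_Eset hnd]; omega)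
    omega

/-- **Additive gluing at every density from the AG level certificate of one graph.** If
`lvGraphAG n (edgeList G)` holds then for every `p`, `A`, `o`, `b`, `t ≥ 0` with `P_p(a ↔ b) ≥ 1 − t`
on `A`: `P_p(o ↔ A) − t ≤ P_p(o ↔ b)` (`P(o ↔ A) ≤ P({o ↔ A} ∖ {o ↔ b}) + P(o ↔ b)` and the relay;
the triples skipped by the checker — `o ∈ A`, `o = b`, `A = ∅` — hold by `P ≤ 1`, `P(o ↔ o) = 1`,
`P(∅) = 0`). -/
theorem additiveGluing_uniform_of_lvGraphAG {n : ℕ} (G : SimpleGraph (Fin n))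
    (hg : lvGraphAG n (edgeList G) = true) (p : unitInterval) (A : Finset (Fin n)) (o b : Fin n) (t : ℝ)
    (ht : 0 ≤ t) (hrel : ∀ a ∈ A, 1 - t ≤ (bondPercolation G p).real (openConn a b)) :
    (bondPercolation G p).real (⋃ a ∈ A, openConn o a) - t ≤ (bondPercolation G p).real (openConn o b) := by
  have hPA : (bondPercolation G p).real (⋃ a ∈ A, openConn o a) ≤ 1 := measureReal_le_one
  by_cases hoA : o ∈ A
  · linarith [hrel o hoA]
  by_cases hob : o = b
  · subst hob; rw [real_openConn_self]; linarith
  by_cases hA : A = ∅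
  · subst hA
    simp only [Finset.notMem_empty, Set.iUnion_of_empty, Set.iUnion_empty, measureReal_empty]
    linarith [measureReal_nonneg (μ := bondPercolation G p) (s := openConn o b)]
  obtain ⟨a0, ha0⟩ := Finset.nonempty_iff_ne_empty.2 hA
  obtain ⟨a, haA, hle⟩ := real_diff_le_of_lvGraphAG G hg p A o b hoA hob ha0
  have hsplit : (bondPercolation G p).real (⋃ a ∈ A, openConn o a) ≤
      (bondPercolation G p).real ((⋃ a ∈ A, openConn o a) \ openConn o b) +
        (bondPercolation G p).real (openConn o b) :=
    (measureReal_mono (fun ω hω => by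
      by_cases hb : ω ∈ openConn o b
      · exact Or.inr hb
      · exact Or.inl ⟨hω, hb⟩)).trans (measureReal_union_le _ _)
  linarith [hrel a haA]

/-- **Reach-difference bound at every density from the AG level certificate of one graph.** If
`lvGraphAG n (edgeList G)` holds then for every `p`, `A ∋ a₀`, `o`, `η` with `P_p(a ↔ a₀) ≥ 1 − η`
on `A`: `P_p({o ↔ A} ∖ {o ↔ a₀}) ≤ η` (relay bound with `b := a₀`; for `o ∈ A`,
`{o ↔ A} ∖ {o ↔ a₀} ⊆ {o ↮ a₀}`). -/
theorem reachDiff_uniform_of_lvGraphAG {n : ℕ} (G : SimpleGraph (Fin n))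
    (hg : lvGraphAG n (edgeList G) = true) (p : unitInterval) (A : Finset (Fin n)) (o a₀ : Fin n) (η : ℝ)
    (ha₀ : a₀ ∈ A) (hrel : ∀ a ∈ A, 1 - η ≤ (bondPercolation G p).real (openConn a a₀)) :
    (bondPercolation G p).real ((⋃ a ∈ A, openConn o a) \ openConn o a₀) ≤ η := by
  by_cases hoA : o ∈ A
  · have h1 : (bondPercolation G p).real ((⋃ a ∈ A, openConn o a) \ openConn o a₀) ≤
        (bondPercolation G p).real (openConn o a₀)ᶜ := measureReal_mono fun ω hω => hω.2
    rw [probReal_compl_eq_one_sub (measurableSet_openConn_holds o a₀)] at h1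
    linarith [hrel o hoA]
  obtain ⟨a, haA, hle⟩ := real_diff_le_of_lvGraphAG G hg p A o a₀ hoA (fun h => hoA (h ▸ ha₀)) ha₀
  linarith [hrel a haA]

/-! ## Part 3. Soundness of the pruned search -/

/-- `goIsoL` reaches every sub-list: each is skipped as non-minimal or its extension of the carried
prefix passes `lvGraphAG`. -/
theorem goIsoL_imp {n : ℕ} (pt : List (List (Fin n))) : ∀ (ps acc : List (Fin n × Fin n)) (c : ℕ),
    goIsoL n pt ps acc c = true → ∀ es ∈ ps.sublists',
      nonMinimal n pt (codeAcc n c es) = true ∨ lvGraphAG n (acc ++ es) = true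
  | [], acc, c, h, es, hes => by
    rw [List.sublists'_nil, List.mem_singleton] at hes
    subst hes
    simpa [goIsoL, codeAcc] using h
  | p :: ps, acc, c, h, es, hes => by
    rw [goIsoL, Bool.and_eq_true] at h
    rw [List.sublists'_cons, List.mem_append, List.mem_map] at hes
    rcases hes with hes | ⟨es', hes', rfl⟩
    · exact goIsoL_imp pt ps acc c h.1 es hes
    · rw [List.append_cons]
      exact goIsoL_imp pt ps (acc ++ [p]) _ h.2 es' hes'

/-- The heart of the pruning: for every graph some relabelling of it passed `lvGraphAG`
(a relabelling with MINIMAL code cannot be skipped). -/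
theorem exists_lvGraphAG_of_agIsoL {n : ℕ} (h : agIsoL n = true) (G : SimpleGraph (Fin n)) :
    ∃ σ : Equiv.Perm (Fin n), lvGraphAG n (edgeList (G.map σ)) = true := by
  classical
  obtain ⟨σ, -, hmin⟩ := Finset.exists_min_image Finset.univ
    (fun σ : Equiv.Perm (Fin n) => codeG (G.map σ)) Finset.univ_nonempty
  refine ⟨σ, ?_⟩
  rcases goIsoL_imp (permTabs n) (allPairs n) [] 0 h (edgeList (G.map σ))
    (List.mem_sublists'.2 (edgeList_sublist _)) with hskip | hcheck
  · exfalso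
    rw [show codeAcc n 0 (edgeList (G.map σ)) = codeG (G.map σ) from rfl, nonMinimal,
      List.any_eq_true] at hskip
    obtain ⟨τ, hτ, hlt⟩ := hskip
    obtain ⟨σ', hσ'⟩ := exists_perm_of_mem_permTabs hτ
    rw [Nat.blt_eq, recode_codeG _ σ' τ hσ', codeG_map_map] at hlt
    exact absurd (hmin (σ.trans σ') (Finset.mem_univ _)) (not_le.2 hlt)
  · exact hcheck

/-! ### Relabelling invariance of the probabilities, at every density -/

/-- `P^{σ G}_p(σ x ↔ σ y) = P^G_p(x ↔ y)`. -/
theorem real_openConn_map_perm {n : ℕ} (G : SimpleGraph (Fin n)) (p : unitInterval)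
    (σ : Equiv.Perm (Fin n)) (x y : Fin n) :
    (bondPercolation (G.map σ) p).real (openConn (σ x) (σ y)) =
      (bondPercolation G p).real (openConn x y) := by
  rw [← bondPercolation_real_preimage_relabel_iso (SimpleGraph.Iso.map σ G) p,
    show (SimpleGraph.Iso.map σ G).toEquiv = σ from rfl, preimage_relabel_openConn]

/-- `P^{σ G}_p(σ o ↔ σ A) = P^G_p(o ↔ A)`. -/
theorem real_iUnion_openConn_map_perm {n : ℕ} (G : SimpleGraph (Fin n)) (p : unitInterval)
    (σ : Equiv.Perm (Fin n)) (o : Fin n) (A : Finset (Fin n)) :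
    (bondPercolation (G.map σ) p).real (⋃ a ∈ A, openConn (σ o) (σ a)) =
      (bondPercolation G p).real (⋃ a ∈ A, openConn o a) := by
  rw [← bondPercolation_real_preimage_relabel_iso (SimpleGraph.Iso.map σ G) p,
    show (SimpleGraph.Iso.map σ G).toEquiv = σ from rfl]
  congr 1
  simp only [Set.preimage_iUnion, preimage_relabel_openConn]

/-- `P^{σ G}_p({σ o ↔ σ A} ∖ {σ o ↔ σ b}) = P^G_p({o ↔ A} ∖ {o ↔ b})`. -/
theorem real_diff_map_perm {n : ℕ} (G : SimpleGraph (Fin n)) (p : unitInterval)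
    (σ : Equiv.Perm (Fin n)) (o b : Fin n) (A : Finset (Fin n)) :
    (bondPercolation (G.map σ) p).real ((⋃ a ∈ A, openConn (σ o) (σ a)) \ openConn (σ o) (σ b)) =
      (bondPercolation G p).real ((⋃ a ∈ A, openConn o a) \ openConn o b) := by
  rw [← bondPercolation_real_preimage_relabel_iso (SimpleGraph.Iso.map σ G) p,
    show (SimpleGraph.Iso.map σ G).toEquiv = σ from rfl]
  congr 1
  simp only [Set.preimage_sdiff, Set.preimage_iUnion, preimage_relabel_openConn]

/-- **Soundness (additive gluing, every density).** If `agIsoL n = true` then for EVERY simple graph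
`G` on `Fin n`, every `p` and all `A o b t`: `t ≥ 0` and `P_p(a ↔ b) ≥ 1 − t` on `A` give
`P_p(o ↔ A) − t ≤ P_p(o ↔ b)` (checked on a code-minimal relabelling `G.map σ`, transported back). -/
theorem additiveGluing_uniform_of_agIsoL {n : ℕ} (h : agIsoL n = true) (G : SimpleGraph (Fin n))
    (p : unitInterval) (A : Finset (Fin n)) (o b : Fin n) (t : ℝ) (ht : 0 ≤ t)
    (hrel : ∀ a ∈ A, 1 - t ≤ (bondPercolation G p).real (openConn a b)) :
    (bondPercolation G p).real (⋃ a ∈ A, openConn o a) - t ≤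
      (bondPercolation G p).real (openConn o b) := by
  classical
  obtain ⟨σ, hcheck⟩ := exists_lvGraphAG_of_agIsoL h G
  have hAG := additiveGluing_uniform_of_lvGraphAG (G.map σ) hcheck p (A.image σ) (σ o) (σ b) t ht (by
      intro a' ha'
      obtain ⟨a, ha, rfl⟩ := Finset.mem_image.1 ha'
      rw [real_openConn_map_perm]
      exact hrel a ha)
  rw [Finset.set_biUnion_finset_image, real_iUnion_openConn_map_perm, real_openConn_map_perm] at hAG
  exact hAG

/-- **Soundness (reach-difference bound, every density).** If `agIsoL n = true` then for EVERY simple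
graph `G` on `Fin n`, every `p`, `A ∋ a₀`, `o`, `η` with `P_p(a ↔ a₀) ≥ 1 − η` on `A`:
`P_p({o ↔ A} ∖ {o ↔ a₀}) ≤ η`. -/
theorem reachDiff_uniform_of_agIsoL {n : ℕ} (h : agIsoL n = true) (G : SimpleGraph (Fin n))
    (p : unitInterval) (A : Finset (Fin n)) (o a₀ : Fin n) (η : ℝ) (ha₀ : a₀ ∈ A)
    (hrel : ∀ a ∈ A, 1 - η ≤ (bondPercolation G p).real (openConn a a₀)) :
    (bondPercolation G p).real ((⋃ a ∈ A, openConn o a) \ openConn o a₀) ≤ η := by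
  classical
  obtain ⟨σ, hcheck⟩ := exists_lvGraphAG_of_agIsoL h G
  have hRD := reachDiff_uniform_of_lvGraphAG (G.map σ) hcheck p (A.image σ) (σ o) (σ a₀) η
    (Finset.mem_image_of_mem σ ha₀) (by
      intro a' ha'
      obtain ⟨a, ha, rfl⟩ := Finset.mem_image.1 ha'
      rw [real_openConn_map_perm]
      exact hrel a ha)
  rw [Finset.set_biUnion_finset_image, real_diff_map_perm] at hRD
  exact hRD

/-! ## Part 4. The certificate: all simple graphs on at most six vertices -/

/-- `agIsoL 0 = true` (no vertices). -/
theorem agIsoL_zero : agIsoL 0 = true := by native_decide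

/-- `agIsoL 1 = true`. -/
theorem agIsoL_one : agIsoL 1 = true := by native_decide

/-- `agIsoL 2 = true`. -/
theorem agIsoL_two : agIsoL 2 = true := by native_decide

/-- `agIsoL 3 = true` (4 classes). -/
theorem agIsoL_three : agIsoL 3 = true := by native_decide

/-- `agIsoL 4 = true` (11 classes). -/
theorem agIsoL_four : agIsoL 4 = true := by native_decide

/-- `agIsoL 5 = true` (34 classes). -/
theorem agIsoL_five : agIsoL 5 = true := by native_decide

/-- **The certified computation** `agIsoL 6 = true`: the `2^15` graphs on `Fin 6`, all but the `156`
code-minimal ones skipped, `141 795` sub-configurations, level histograms and the level-wise AG test for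
every `(o, b, A)` (`native_decide`, ≈ 65 s compiled). -/
theorem agIsoL_six : agIsoL 6 = true := by native_decide

/-- `agIsoL n = true` for every `n ≤ 6`. -/
theorem agIsoL_le_six {n : ℕ} (hn : n ≤ 6) : agIsoL n = true := by
  interval_cases n
  · exact agIsoL_zero
  · exact agIsoL_one
  · exact agIsoL_two
  · exact agIsoL_three
  · exact agIsoL_four
  · exact agIsoL_five
  · exact agIsoL_six

/-- **Certificate (additive gluing, every density, at most six vertices).** For every simple graph
`G` on `Fin n`, `n ≤ 6`, Bernoulli bond percolation with ANY parameter `p`, every relay set `A`,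
vertices `o b` and slack `t ≥ 0` with `P_p(a ↔ b) ≥ 1 − t` for all `a ∈ A`:
`P_p(o ↔ A) − t ≤ P_p(o ↔ b)`. -/
theorem additiveGluing_uniform_le_six : ∀ (n : ℕ), n ≤ 6 → ∀ (G : SimpleGraph (Fin n)) (p : unitInterval) (A : Finset (Fin n)) (o b : Fin n) (t : ℝ), 0 ≤ t → (∀ a ∈ A, 1 - t ≤ (Literature.Probability.Percolation.bondPercolation G p).real (Literature.Probability.Percolation.openConn a b)) → (Literature.Probability.Percolation.bondPercolation G p).real (⋃ a ∈ A, Literature.Probability.Percolation.openConn o a) - t ≤ (Literature.Probability.Percolation.bondPercolation G p).real (Literature.Probability.Percolation.openConn o b) := by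
  intro n hn G p A o b t ht hrel
  exact additiveGluing_uniform_of_agIsoL (agIsoL_le_six hn) G p A o b t ht hrel

/-- **Certificate (additive gluing, every density, the complete graph `K₆`).** The special case
`G = ⊤` on `Fin 6` of `additiveGluing_uniform_le_six`. -/
theorem additiveGluing_uniform_completeSix : ∀ (p : unitInterval) (A : Finset (Fin 6)) (o b : Fin 6) (t : ℝ), 0 ≤ t → (∀ a ∈ A, 1 - t ≤ (Literature.Probability.Percolation.bondPercolation (⊤ : SimpleGraph (Fin 6)) p).real (Literature.Probability.Percolation.openConn a b)) → (Literature.Probability.Percolation.bondPercolation (⊤ : SimpleGraph (Fin 6)) p).real (⋃ a ∈ A, Literature.Probability.Percolation.openConn o a) - t ≤ (Literature.Probability.Percolation.bondPercolation (⊤ : SimpleGraph (Fin 6)) p).real (Literature.Probability.Percolation.openConn o b) := by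
  intro p A o b t ht hrel
  exact additiveGluing_uniform_le_six 6 le_rfl ⊤ p A o b t ht hrel

/-- **Certificate (reach-difference bound, every density, at most six vertices).** For every simple
graph `G` on `Fin n`, `n ≤ 6`, ANY `p`, every `A ∋ a₀`, `o` and `η` with `P_p(a ↔ a₀) ≥ 1 − η` for all
`a ∈ A`: `P_p({o ↔ A} ∖ {o ↔ a₀}) ≤ η`. -/
theorem reachDiff_uniform_le_six {n : ℕ} (hn : n ≤ 6) (G : SimpleGraph (Fin n)) (p : unitInterval)
    (A : Finset (Fin n)) (o a₀ : Fin n) (η : ℝ) (ha₀ : a₀ ∈ A)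
    (hrel : ∀ a ∈ A, 1 - η ≤ (bondPercolation G p).real (openConn a a₀)) :
    (bondPercolation G p).real ((⋃ a ∈ A, openConn o a) \ openConn o a₀) ≤ η :=
  reachDiff_uniform_of_agIsoL (agIsoL_le_six hn) G p A o a₀ η ha₀ hrel

end Summit.CriticalPhenomena.PercolationContinuityZ3.Theorems
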